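import Mathlib.LinearAlgebra.Projection
import Literature.NumberTheory.GaloisRepresentations.CoinvariantsQuadraticTwist
import HarnessLib

/-!
# Coinvariants of a representation twisted by a quadratic character, II: the ramified case

Topic `NumberTheory/GaloisRepresentations`; sibling of `CoinvariantsQuadraticTwist` (local Artin
formalism for a quadratic base change, on inertia coinvariants).  Let `ρ` be a representation of
`G` on a finite-dimensional vector space `V` over a field `k` with `2 ≠ 0`, `I ⊴ G` a normal
subgroup (inertia), `χ : G → kˣ` a character with `χ(I) ⊆ {±1}` which is *ramified*, i.e.
`χ(τ) = -1` for some `τ ∈ I`, and `J = I ∩ ker χ` (the inertia group of the quadratic extension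
cut out by `χ`).  Then for every `Φ ∈ G` with `χ(Φ) = 1` (a Frobenius of the quadratic
extension at a ramified prime)

  `charpoly(Φ ∣ V_J) = charpoly(Φ ∣ V_I) · charpoly(Φ ∣ (V ⊗ χ)_I)`

(`charpoly_toCoinvariants_inf_ker_eq_mul`), whence `L_w(V|_{Γ_K}, T) = L_v(V, T) · L_v(V ⊗ χ, T)`
at a prime `v` of `ℚ` ramified in the quadratic field `K` (`w² = v`, `f(w|v) = 1`): the ramified
case of Ireland–Rosen, *A Classical Introduction to Modern Number Theory*, Prop. 20.5.4(b), for
`V = V_ℓ E` and the Euler factors `det(1 - Frob T ∣ V_{I})` of Serre, *Facteurs locaux* (1970),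
§2.3.  Proof: `τ` acts on `V_J` as an involution `t` commuting with `Φ`; `V_I = V_J/(t - 1)V_J`
and `(V ⊗ χ)_I = V_J/(t + 1)V_J` (`ker_comp_subtype_eq_sup_range`,
`ker_twist_comp_subtype_eq_sup_range` of the sibling file), and for an involution on a space with
`2 ≠ 0`, `V_J = (t - 1)V_J ⊕ (t + 1)V_J` with `V_J/(t ∓ 1)V_J ≅ (t ± 1)V_J`
(`LinearMap.charpoly_eq_mul_of_mul_self_eq_one`).  Everything here is proved; no definitions.

## References

* K. Ireland, M. Rosen, *A Classical Introduction to Modern Number Theory*, 2nd ed., GTM 84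
  (1990), Ch. 20 §5, Prop. 20.5.4(b). [IrelandRosen1990]
* J.-P. Serre, *Facteurs locaux des fonctions zêta des variétés algébriques*, Sém. DPP 1969/70,
  exp. 19, §2.3; J. Neukirch, *Algebraic Number Theory* (1999), VII §10, proof of (10.4).
  [NeukirchANT1999]
-/

noncomputable section

open Polynomial Literature.RepresentationTheory.Semisimple

namespace Literature.NumberTheory.GaloisRepresentations

universe u v w

/-! ### Linear algebra of an involution commuting with an endomorphism -/

section Involution

variable {k : Type u} [Field k] {W : Type v} [AddCommGroup W] [Module k W] [FiniteDimensional k W]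

omit [FiniteDimensional k W] in
/-- For an involution `t` (`t² = 1`) on a vector space with `2 ≠ 0`, the images of `t - 1` and
`t + 1` (the `∓1`-eigenspaces) are complementary. [folklore] -/
theorem isCompl_range_sub_one_range_add_one (h2 : (2 : k) ≠ 0) {t : Module.End k W}
    (ht : t * t = 1) : IsCompl (LinearMap.range (t - 1)) (LinearMap.range (t + 1)) := by
  have htt : ∀ x, t (t x) = x := fun x => by
    rw [← Module.End.mul_apply, ht, Module.End.one_apply]
  constructor
  · rw [Submodule.disjoint_def]
    rintro x ⟨a, rfl⟩ ⟨b, hb⟩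
    have h1 : t ((t - 1) a) = -((t - 1) a) := by
      simp only [LinearMap.sub_apply, Module.End.one_apply, map_sub, htt, neg_sub]
    have h2' : t ((t + 1) b) = (t + 1) b := by
      simp only [LinearMap.add_apply, Module.End.one_apply, map_add, htt, add_comm]
    rw [hb] at h2'
    have h3 : (2 : k) • ((t - 1) a) = 0 := by
      rw [two_smul]
      nth_rewrite 1 [← h2']
      rw [h1, neg_add_cancel]
    exact (smul_eq_zero.mp h3).resolve_left h2
  · rw [codisjoint_iff, eq_top_iff]
    intro w _
    have hw : (2 : k) • w = (t + 1) w - (t - 1) w := by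
      simp only [LinearMap.add_apply, LinearMap.sub_apply, Module.End.one_apply, two_smul]
      abel
    have h2w : (2 : k) • w ∈ LinearMap.range (t - 1) ⊔ LinearMap.range (t + 1) := by
      rw [hw]
      exact Submodule.sub_mem _ (Submodule.mem_sup_right ⟨w, rfl⟩)
        (Submodule.mem_sup_left ⟨w, rfl⟩)
    have := Submodule.smul_mem _ (2 : k)⁻¹ h2w
    rwa [inv_smul_smul₀ h2] at this

/-- If `p, q` are complementary subspaces, `F` preserves `q`, and `π : W → Q` is a surjection
with kernel `p` intertwining `F` with `F'`, then `F|_q` and `F'` have the same characteristic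
polynomial (`π` restricts to an isomorphism `q ≅ Q`). [folklore] -/
theorem charpoly_restrict_eq_of_isCompl {p q : Submodule k W} (hpq : IsCompl p q)
    {F : Module.End k W} (hq : ∀ x ∈ q, F x ∈ q)
    {Q : Type w} [AddCommGroup Q] [Module k Q] [FiniteDimensional k Q]
    (π : W →ₗ[k] Q) (hπ : Function.Surjective π) (hk : LinearMap.ker π = p)
    {F' : Module.End k Q} (hFπ : π ∘ₗ F = F' ∘ₗ π) :
    (F.restrict hq).charpoly = F'.charpoly := by
  have hinj : Function.Injective (π ∘ₗ q.subtype) := by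
    rw [← LinearMap.ker_eq_bot, Submodule.eq_bot_iff]
    intro x hx
    rw [LinearMap.mem_ker, LinearMap.comp_apply, Submodule.subtype_apply, ← LinearMap.mem_ker,
      hk] at hx
    exact Subtype.ext ((Submodule.disjoint_def.1 hpq.disjoint) _ hx x.2)
  have hsurj : Function.Surjective (π ∘ₗ q.subtype) := by
    intro y
    obtain ⟨w, rfl⟩ := hπ y
    have hw : w ∈ p ⊔ q := by rw [hpq.sup_eq_top]; exact Submodule.mem_top
    obtain ⟨a, ha, b, hb, rfl⟩ := Submodule.mem_sup.1 hw
    refine ⟨⟨b, hb⟩, ?_⟩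
    have ha0 : π a = 0 := by rw [← LinearMap.mem_ker, hk]; exact ha
    simp [ha0]
  refine charpoly_eq_of_semiconj (LinearEquiv.ofBijective (π ∘ₗ q.subtype) ⟨hinj, hsurj⟩)
    fun x => ?_
  simp only [LinearEquiv.ofBijective_apply, LinearMap.comp_apply, Submodule.subtype_apply,
    LinearMap.coe_restrict_apply]
  exact LinearMap.congr_fun hFπ (x : W)

/-- **An endomorphism compatible with an involution.**  Let `t` be an involution (`t² = 1`) of
a finite-dimensional vector space `W` over a field with `2 ≠ 0` and `F` an endomorphism.  If
`π₁ : W → Q₁` and `π₂ : W → Q₂` are surjections with kernels `(t - 1)W` and `(t + 1)W`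
intertwining `F` with endomorphisms `F₁` and `F₂` (so that `F` preserves both eigenspaces of `t`,
e.g. `F` commutes with `t`), then `charpoly F = charpoly F₁ · charpoly F₂`
(`W = (t-1)W ⊕ (t+1)W`, both summands `F`-stable, and `Q₁ ≅ (t+1)W`, `Q₂ ≅ (t-1)W`).
[folklore] -/
theorem LinearMap.charpoly_eq_mul_of_mul_self_eq_one (h2 : (2 : k) ≠ 0) {t F : Module.End k W}
    (ht : t * t = 1)
    {Q₁ : Type w} [AddCommGroup Q₁] [Module k Q₁] [FiniteDimensional k Q₁]
    (π₁ : W →ₗ[k] Q₁) (hπ₁ : Function.Surjective π₁)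
    (hk₁ : LinearMap.ker π₁ = LinearMap.range (t - 1)) {F₁ : Module.End k Q₁}
    (hF₁ : π₁ ∘ₗ F = F₁ ∘ₗ π₁)
    {Q₂ : Type w} [AddCommGroup Q₂] [Module k Q₂] [FiniteDimensional k Q₂]
    (π₂ : W →ₗ[k] Q₂) (hπ₂ : Function.Surjective π₂)
    (hk₂ : LinearMap.ker π₂ = LinearMap.range (t + 1)) {F₂ : Module.End k Q₂}
    (hF₂ : π₂ ∘ₗ F = F₂ ∘ₗ π₂) :
    F.charpoly = F₁.charpoly * F₂.charpoly := by
  set p := LinearMap.range (t - 1) with hp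
  set q := LinearMap.range (t + 1) with hq
  have hpq : IsCompl p q := isCompl_range_sub_one_range_add_one h2 ht
  -- `F` preserves `p = ker π₁` and `q = ker π₂`
  have hFp : ∀ x ∈ p, F x ∈ p := fun x hx => by
    rw [← hk₁, LinearMap.mem_ker] at hx ⊢
    have := LinearMap.congr_fun hF₁ x
    simp only [LinearMap.comp_apply] at this
    rw [this, hx, map_zero]
  have hFq : ∀ x ∈ q, F x ∈ q := fun x hx => by
    rw [← hk₂, LinearMap.mem_ker] at hx ⊢
    have := LinearMap.congr_fun hF₂ x
    simp only [LinearMap.comp_apply] at this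
    rw [this, hx, map_zero]
  -- `charpoly F = charpoly F|_p · charpoly F|_q`
  have hprod : F.charpoly = (F.restrict hFp).charpoly * (F.restrict hFq).charpoly := by
    rw [← LinearMap.charpoly_prodMap]
    refine (charpoly_eq_of_semiconj (Submodule.prodEquivOfIsCompl p q hpq) fun x => ?_).symm
    simp only [Submodule.coe_prodEquivOfIsCompl', LinearMap.prodMap_apply,
      LinearMap.coe_restrict_apply, map_add]
  rw [hprod, charpoly_restrict_eq_of_isCompl hpq hFq π₁ hπ₁ hk₁ hF₁,
    charpoly_restrict_eq_of_isCompl hpq.symm hFp π₂ hπ₂ hk₂ hF₂, mul_comm]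

end Involution

/-! ### The ramified case of local Artin formalism for a quadratic twist -/

section Ramified

variable {k : Type u} [Field k] {G : Type v} [Group G] {V : Type w} [AddCommGroup V] [Module k V]

/-- For submodules `A ≤ K'` with `K' = A + range u`, where `u` descends to `ū` on `V ⧸ A`,
the kernel of the quotient map `V ⧸ A → V ⧸ K'` is `range ū`. [folklore] -/
theorem Submodule.ker_mapQ_id_eq_range_of_eq_sup {A K' : Submodule k V} {u : Module.End k V}
    (hK' : K' = A ⊔ LinearMap.range u) {ubar : Module.End k (V ⧸ A)}
    (hu : A.mkQ ∘ₗ u = ubar ∘ₗ A.mkQ) (hle : A ≤ K'.comap LinearMap.id) :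
    LinearMap.ker (A.mapQ K' LinearMap.id hle) = LinearMap.range ubar := by
  rw [Submodule.mapQ, Submodule.ker_liftQ, LinearMap.ker_comp, Submodule.ker_mkQ,
    Submodule.comap_id, hK', Submodule.map_sup, Submodule.mkQ_map_self, bot_sup_eq,
    ← LinearMap.range_comp, hu]
  exact LinearMap.range_comp_of_range_eq_top _ (Submodule.range_mkQ _)

variable [FiniteDimensional k V]

/-- **Local Artin formalism at a ramified prime (coinvariant form).**  Let `ρ : G → GL(V)` be a
representation on a finite-dimensional vector space over a field with `2 ≠ 0`, `I ⊴ G` a normal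
subgroup, `χ : G → kˣ` a character with `χ(I) ⊆ {±1}` and `χ(τ) = -1` for some `τ ∈ I`, and
`Φ ∈ G` with `χ(Φ) = 1`.  Then the characteristic polynomial of `Φ` on the coinvariants
`V_{I ∩ ker χ}` is the product of its characteristic polynomials on `V_I` and on the coinvariants
`(V ⊗ χ)_I` of the twist.  Applied to `G = D_𝔓 ≤ Γ_ℚ` a decomposition group at a prime ramified
in the quadratic field `K = ℚ̄^{ker χ}`, `I = I_𝔓`, `V = V_ℓ E`, `Φ` a Frobenius of `K` (so
`I ∩ ker χ` is the inertia group of `K` and `V ⊗ χ = V_ℓ E^{(d_K)}`), and reversed, this is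
`L_w(E/K, T) = L_p(E, T) · L_p(E^{(d_K)}, T)` — Ireland–Rosen, Prop. 20.5.4(b) at the ramified
primes. [cite: IrelandRosen1990, Ch. 20 §5, Prop. 20.5.4(b)] -/
theorem charpoly_toCoinvariants_inf_ker_eq_mul (h2 : (2 : k) ≠ 0) (ρ : Representation k G V)
    (I : Subgroup G) [I.Normal] (χ : G →* kˣ) (hχI : ∀ i ∈ I, χ i = 1 ∨ χ i = -1)
    {τ : G} (hτ : τ ∈ I) (hχτ : χ τ = -1) {Φ : G} (hΦ : χ Φ = 1) :
    (ρ.toCoinvariants (I ⊓ χ.ker) Φ).charpoly =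
      (ρ.toCoinvariants I Φ).charpoly *
        ((Representation.twist ρ χ).toCoinvariants I Φ).charpoly := by
  set J : Subgroup G := I ⊓ χ.ker with hJ
  -- the coset decomposition `I = J ∪ J τ`
  have hJI : J ≤ I := inf_le_left
  have hχJ : ∀ j ∈ J, χ j = 1 := fun j hj => (Subgroup.mem_inf.1 hj).2
  have hIJ : ∀ i ∈ I, i ∈ J ∨ i * τ⁻¹ ∈ J := fun i hi => by
    rcases hχI i hi with h | h
    · exact Or.inl ⟨hi, h⟩
    · refine Or.inr (Subgroup.mem_inf.2 ⟨I.mul_mem hi (I.inv_mem hτ), ?_⟩)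
      rw [MonoidHom.mem_ker, map_mul, map_inv, h, hχτ, mul_inv_cancel]
  -- the involution `t = τ̄` on `W = V_J` and `F = Φ̄`
  set t : Module.End k (Representation.Coinvariants (ρ.comp J.subtype)) :=
    ρ.toCoinvariants J τ with ht_def
  set F : Module.End k (Representation.Coinvariants (ρ.comp J.subtype)) :=
    ρ.toCoinvariants J Φ with hF_def
  have ht : t * t = 1 := by
    rw [ht_def, ← map_mul]
    refine toCoinvariants_eq_one_of_mem ρ J (Subgroup.mem_inf.2 ⟨I.mul_mem hτ hτ, ?_⟩)
    rw [MonoidHom.mem_ker, map_mul, hχτ, neg_mul_neg, one_mul]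
  -- descent of `ρ τ ∓ 1` to `t ∓ 1`
  have hdesc₁ : (Representation.Coinvariants.ker (ρ.comp J.subtype)).mkQ ∘ₗ (ρ τ - 1) =
      (t - 1) ∘ₗ (Representation.Coinvariants.ker (ρ.comp J.subtype)).mkQ :=
    LinearMap.ext fun x => rfl
  have hdesc₂ : (Representation.Coinvariants.ker (ρ.comp J.subtype)).mkQ ∘ₗ (ρ τ + 1) =
      (t + 1) ∘ₗ (Representation.Coinvariants.ker (ρ.comp J.subtype)).mkQ :=
    LinearMap.ext fun x => rfl
  -- the surjection `π₁ : V_J → V_I` and `π₂ : V_J → (V ⊗ χ)_I`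
  have hle₁ : Representation.Coinvariants.ker (ρ.comp J.subtype) ≤
      (Representation.Coinvariants.ker (ρ.comp I.subtype)).comap LinearMap.id := by
    rw [Submodule.comap_id]; exact ker_comp_subtype_mono ρ hJI
  have hle₂ : Representation.Coinvariants.ker (ρ.comp J.subtype) ≤
      (Representation.Coinvariants.ker ((Representation.twist ρ χ).comp I.subtype)).comap
        LinearMap.id := by
    rw [Submodule.comap_id, ← ker_twist_comp_subtype_eq ρ χ hχJ]
    exact ker_comp_subtype_mono _ hJI
  set π₁ := (Representation.Coinvariants.ker (ρ.comp J.subtype)).mapQ _ LinearMap.id hle₁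
    with hπ₁_def
  set π₂ := (Representation.Coinvariants.ker (ρ.comp J.subtype)).mapQ _ LinearMap.id hle₂
    with hπ₂_def
  have hsurj₁ : Function.Surjective π₁ := fun y =>
    Submodule.Quotient.induction_on _ y fun v => ⟨Submodule.Quotient.mk v, rfl⟩
  have hsurj₂ : Function.Surjective π₂ := fun y =>
    Submodule.Quotient.induction_on _ y fun v => ⟨Submodule.Quotient.mk v, rfl⟩
  have hk₁ : LinearMap.ker π₁ = LinearMap.range (t - 1) :=
    Submodule.ker_mapQ_id_eq_range_of_eq_sup (ker_comp_subtype_eq_sup_range ρ hJI hτ hIJ)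
      hdesc₁ hle₁
  have hk₂ : LinearMap.ker π₂ = LinearMap.range (t + 1) :=
    Submodule.ker_mapQ_id_eq_range_of_eq_sup
      (ker_twist_comp_subtype_eq_sup_range ρ χ hJI hτ hIJ hχJ hχτ) hdesc₂ hle₂
  have hF₁ : π₁ ∘ₗ F = ρ.toCoinvariants I Φ ∘ₗ π₁ :=
    Representation.Coinvariants.hom_ext (LinearMap.ext fun x => rfl)
  have hF₂ : π₂ ∘ₗ F = (Representation.twist ρ χ).toCoinvariants I Φ ∘ₗ π₂ := by
    refine Representation.Coinvariants.hom_ext (LinearMap.ext fun x => ?_)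
    change Submodule.Quotient.mk (ρ Φ x) =
      Submodule.Quotient.mk (Representation.twist ρ χ Φ x)
    rw [Representation.twist_apply, hΦ, Units.val_one, one_smul]
  exact LinearMap.charpoly_eq_mul_of_mul_self_eq_one h2 ht π₁ hsurj₁ hk₁ hF₁ π₂ hsurj₂ hk₂ hF₂

end Ramified

/-! ### Transport of coinvariants along an equivariant isomorphism -/

section Transport

variable {k : Type u} [Field k] {G : Type v} [Group G] {G' : Type*} [Group G']
  {V : Type w} [AddCommGroup V] [Module k V] [FiniteDimensional k V]
  {V' : Type*} [AddCommGroup V'] [Module k V'] [FiniteDimensional k V']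

/-- **Coinvariants are transported along an equivariant isomorphism.**  Let `f : G' → G` be a
group homomorphism, `E : V' ≃ V` a linear isomorphism intertwining `ρ'` with `ρ ∘ f`, and
`S' ⊴ G'`, `S ⊴ G` normal subgroups with `S = f(S')`.  Then for every `g' ∈ G'` the action of `g'`
on `V'_{S'}` and that of `f g'` on `V_S` have the same characteristic polynomial (`E` maps
`⟨ρ'(s')x - x⟩` onto `⟨ρ(s)v - v⟩` and descends to `V'_{S'} ≃ V_S`).  Used with `f` the
restriction `D_𝔔 → D_𝔓` of `Γ_K → Γ_ℚ` to a decomposition group (`S'` the inertia of `K`,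
`S = I_𝔓 ∩ Γ_K`) and `V' = V_ℓ(E_K) ≅ V_ℓ(E) = V`, and with `f = id`, `V' = V_ℓ(E^{(D)}) ≅
V_ℓ(E) ⊗ χ`. [folklore] -/
theorem charpoly_toCoinvariants_eq_of_equiv (ρ : Representation k G V)
    (ρ' : Representation k G' V') (f : G' →* G) (E : V' ≃ₗ[k] V)
    (hE : ∀ (g' : G') (x : V'), E (ρ' g' x) = ρ (f g') (E x))
    (S : Subgroup G) [S.Normal] (S' : Subgroup G') [S'.Normal] (hS : S = S'.map f) (g' : G') :
    (ρ'.toCoinvariants S' g').charpoly = (ρ.toCoinvariants S (f g')).charpoly := by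
  have hmap : (Representation.Coinvariants.ker (ρ'.comp S'.subtype)).map (E : V' →ₗ[k] V) =
      Representation.Coinvariants.ker (ρ.comp S.subtype) := by
    unfold Representation.Coinvariants.ker
    rw [Submodule.map_span]
    congr 1
    ext v
    simp only [Set.mem_image, Set.mem_range, Prod.exists, comp_subtype_apply]
    constructor
    · rintro ⟨_, ⟨s', x, rfl⟩, rfl⟩
      refine ⟨⟨f s', hS ▸ Subgroup.mem_map_of_mem f s'.2⟩, E x, ?_⟩
      simp only [map_sub, LinearEquiv.coe_coe, hE]
    · rintro ⟨s, v, rfl⟩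
      have hs : (s : G) ∈ S'.map f := hS ▸ s.2
      obtain ⟨s', hs', hs'eq⟩ := Subgroup.mem_map.1 hs
      refine ⟨ρ' s' (E.symm v) - E.symm v, ⟨⟨s', hs'⟩, E.symm v, rfl⟩, ?_⟩
      simp only [map_sub, LinearEquiv.coe_coe, hE, LinearEquiv.apply_symm_apply, hs'eq]
  refine charpoly_eq_of_semiconj (Submodule.Quotient.equiv _ _ E hmap) fun x => ?_
  induction x using Submodule.Quotient.induction_on with
  | H v =>
    change Submodule.Quotient.equiv _ _ E hmap (Submodule.Quotient.mk (ρ' g' v)) =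
      ρ.toCoinvariants S (f g') (Submodule.Quotient.equiv _ _ E hmap (Submodule.Quotient.mk v))
    rw [Submodule.Quotient.equiv_apply, Submodule.Quotient.equiv_apply, Submodule.mapQ_apply,
      Submodule.mapQ_apply]
    change Submodule.Quotient.mk (E (ρ' g' v)) = Submodule.Quotient.mk (ρ (f g') (E v))
    rw [hE]

end Transport

end Literature.NumberTheory.GaloisRepresentations
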